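import Summits.QuantumAdvantage.QuantumAdvantage.Theorems.LinnikCubicClassGroupsDegreeOnePrimesEscapeAbelianChebotarevLinnik
import Literature.NumberTheory.GaloisRepresentations.ArtinReciprocityAbelian
import HarnessLib

/-!
# Linnik's theorem for cosets of a congruence class group, XII: the Chebotarev–Linnik theorem for every ABELIAN
# extension, unconditionally

Topic `Summits/QuantumAdvantage/QuantumAdvantage/Theorems`, cell B2b-1 (linnik-cubic), PART A (gen 23); helper toward
the crux `DegreeOnePrimesEscape` (stmt-QuantumAdvantage-11543) of route `LinnikCubicClassGroups`.  HONEST FRAMING: the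
value of this file is a THEOREM (kernel-checked, GRH-free, Siegel-free) — NOT summit progress (the route still rests on
the hypothesis-type target `PureCubicClassNumberHard`).

`exists_degOnePrime_frobenius_eq_of_commute`: file XI (`exists_degOnePrime_frobenius_eq`) combined with the tree's
finite-level Artin reciprocity law for abelian extensions (`exists_modulus_artinKillsRay_of_commute`, Childress
Thm. 5.2.1): for `n > 1` there is `L = L(n) > 0` such that for every number field `K` of degree `n` and every finite
Galois `N/K` with COMMUTATIVE group there is a modulus `𝔪 ≠ 0` of `K`, whose prime divisors are exactly the primes
ramified in `N`, such that every `σ ∈ Gal(N/K)` is the Frobenius of a prime `𝔭 ∤ 𝔪` of `K` (so unramified in `N`) of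
residue degree one with `N𝔭 ≤ (|d_K| n^n N𝔪)^L` — no hypothesis beyond commutativity (the modulus is an admissible
modulus of class field theory, not made explicit here; the exponent depends only on `[K:ℚ]`).
References: A. Weiss, J. reine angew. Math. 338 (1983), §6 [Weiss1983]; N. Childress, Class Field Theory (2009),
Ch. 5 Thm 2.1 [Childress2009].
-/

noncomputable section

open NumberField IsDedekindDomain
open scoped NumberField

namespace Summit.QuantumAdvantage.QuantumAdvantage.Theorems.DegreeOnePrimesEscape

open Literature.NumberTheory.LFunctions Literature.NumberTheory.LFunctions.NumberField
  Literature.NumberTheory.LFunctions.AbelianDensity Literature.NumberTheory.GaloisRepresentations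

/-- **The Chebotarev–Linnik theorem for every finite abelian extension of number fields, with an exponent depending
only on the degree of the base field, unconditionally** (see the module docstring). [cite: Weiss1983, §6]
[cite: Childress2009, Ch. 5 §2 Thm. 2.1] -/
theorem exists_degOnePrime_frobenius_eq_of_commute (n : ℕ) (hn : 1 < n) :
    ∃ L : ℝ, 0 < L ∧ ∀ (K : Type) [Field K] [NumberField K], Module.finrank ℚ K = n →
    ∀ (N : Type) [Field N] [NumberField N] [Algebra K N] [IsGalois K N],
      (∀ a b : N ≃ₐ[K] N, Commute a b) →
      ∃ 𝔪 : Ideal (𝓞 K), 𝔪 ≠ ⊥ ∧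
        (∀ v : HeightOneSpectrum (𝓞 K), 𝔪 ≤ v.asIdeal ↔ ¬ Algebra.IsUnramifiedIn (𝓞 N) v.asIdeal) ∧
        ∀ σ : N ≃ₐ[K] N, ∃ v : HeightOneSpectrum (𝓞 K), ¬ 𝔪 ≤ v.asIdeal ∧
          Algebra.IsUnramifiedIn (𝓞 N) v.asIdeal ∧
          (Ideal.absNorm v.asIdeal).Prime ∧ (Ideal.absNorm v.asIdeal : ℝ) ≤ rayCondQ K 𝔪 ^ L ∧
          ∀ Q ∈ v.asIdeal.primesOver (𝓞 N), ∀ φ : N ≃ₐ[K] N, IsArithFrobAt (𝓞 K) φ Q → φ = σ := by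
  obtain ⟨L, hL, h⟩ := exists_degOnePrime_frobenius_eq n hn
  refine ⟨L, hL, fun K _ _ hKn N _ _ _ _ hcomm ↦ ?_⟩
  obtain ⟨𝔪, h𝔪, hiff, hray⟩ := exists_modulus_artinKillsRay_of_commute K N hcomm
  exact ⟨𝔪, h𝔪, hiff, h K hKn N hcomm 𝔪 h𝔪 hray (fun v hv ↦ (hiff v).2 hv)⟩

end Summit.QuantumAdvantage.QuantumAdvantage.Theorems.DegreeOnePrimesEscape

end
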